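import Summits.Ventures.GridStability.Models.ClassicalSwingLurie
import Literature.MathematicalPhysics.PowerSystems.StrictSectorBound

/-!
# GridStability/Models/LurieChannelBounds — certified enclosures of the SHIFTED channel angles of the
# lossy Lur'e object and the rational gain / face bounds its circle-criterion ROA theorem consumes

Cell `gridfusion` (LADDER-GRIDFUSION, lossy tier: lit-6 `LossyMultimachineLurieForm.lean` p492860 +
`LurieQuadraticCertificate.lean`; model side `Models/ClassicalSwingLurie.lean` p493501), seat gridfusion-model-1 (g4).

WHY. `RecastData.lurie_roa` / `WSCC9.lurie_roa` (p493501) are conditional on an exact circle-criterion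
certificate `Λ` AND on three side conditions that contain the irrational shifted channel angles
`δ*_k = θ*_p − θ*_q + θ_pq` (`θ_pq = arctan(G_pq/B_pq)`) and `π`: the strict gains
`hg : Λ.g < sectorGain δ*_k = (1 − sin|δ*_k|)/(π/2 − |δ*_k|)` [VT TAC 2017 §4.1], the window `hδs` (done in
p493501) and the level `hlev : lev < (π/2 − |δ*_k|)²/s_k`. This file makes `hg` and `hlev` DECIDABLE:
* pure real (`AngleEnclosure`): `lowerTestSq` / `upperTestSq` / `sinTestSq` — the five- and four-doubling chains
  of `AngleEnclosure` (p482834, ℚ mirrors p491061) read on a SQUARED cosine `cos²x · Y² = m²` and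
  `sin²x · Y² = n²` (the channel angle has an irrational cosine `m/Y`, `Y = √(B² + G²)`, but RATIONAL `m²`,
  `n²`, `Y²`), `angle_gt_of_lowerTestSq`, `angle_lt_of_upperTestSq`, `abs_sin_le_of_sinTestSq`, and the two
  monotone bounds `sectorGain_ge_of_bounds` (`(1 − s)/(P/2 − L) ≤ sectorGain x` from `|sin x| ≤ s ≤ 1`,
  `L ≤ |x|`, `π ≤ P`) and `sq_halfpi_sub_ge_of_bounds`;
* on `RecastData` (generic): `dirSinB = B·sd + G·cd` (`= Y sin(δˢ + θ)`), `Ysq = B² + G²`,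
  `cos_sq_dirAngle` / `sin_sq_dirAngle` (the rational squares), `θpol_self_eq_zero` (zero self-susceptance in
  the typed reductions ⇒ the weightless diagonal channels have shift `0`), `channel_lo_le` / `channel_le_hi` /
  `channel_abs_sin_le` from per-pair tables passing the tests in ONE `decide`, `gainLoQ_le_sectorGain`,
  `faceLoQ_le`;
* INSTANCE «WSCC9-postB-SPdamp-h12» (`WSCC9.postB_SPdamp`, transfer conductances kept): 3 × 3 tables on the
  `10⁻⁵` grid (`chanLo`, `chanHi`, `chanSinHi`; VALIDATED floats of `|δ*|`: 28.16°, 14.27° (1→2, 1→3),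
  49.62°, 23.77° (2→1, 2→3), 34.34°, 5.40° (3→1, 3→2); diagonal 0), and the CERTIFIED consequences
  `WSCC9.postB_SPdamp_sectorGain_ge : ∀ k, 169/500 ≤ sectorGain(δ*_k)` (min exact bound 0.338044 on channel
  2→1; true value 0.33806) and `WSCC9.postB_SPdamp_face_ge : ∀ k, faceLoQ k ≤ (π/2 − |δ*_k|)²` — so for a
  certificate with rational `g < 169/500`, rational `s_k` and `lev < min_k faceLoQ_k/s_k` the hypotheses
  `hg`/`hlev` of `WSCC9.lurie_roa` are ONE `norm_num`/`decide` each (`WSCC9.hg_of_lt`).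
THREE COLUMNS. CERTIFIED: enclosures and bounds about the typed object's exact data. VALIDATED: the degree
floats. MODELLED: as `Models/WSCC9.lean` (MV-2 + MV-P + MV-SPD + MV-ω + MV-h12, conductances as printed).
No certificate is claimed; no sentence here says a grid is stable.
-/

noncomputable section

open Real Set Finset
open Literature.MathematicalPhysics.PowerSystems (InternalNode)
open Literature.MathematicalPhysics.PowerSystems.LyapunovFunctionFamily

namespace Summit.Ventures.GridStability.Models

/-! ### Pure real lemmas: chains on a squared cosine, sine test, gain and face bounds -/

namespace AngleEnclosure

/-- Decidable LOWER test on a squared cosine: `cos²x·Y² = m²`, `q ≤ 3`, chain side conditions,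
`cosLower5Q q ≥ 0` and `m² < cosLower5Q(q)²·Y²`. -/
def lowerTestSq (m2 Y2 q : ℚ) : Bool :=
  decide (q ≤ 3) && decide (0 ≤ 1 - (q / 32) ^ 2 / 2) && decide (0 ≤ dblQ (1 - (q / 32) ^ 2 / 2))
    && decide (0 ≤ dblQ (dblQ (1 - (q / 32) ^ 2 / 2)))
    && decide (0 ≤ dblQ (dblQ (dblQ (1 - (q / 32) ^ 2 / 2))))
    && decide (0 ≤ dblQ (dblQ (dblQ (dblQ (1 - (q / 32) ^ 2 / 2)))))
    && decide (0 ≤ cosLower5Q q) && decide (m2 < cosLower5Q q ^ 2 * Y2)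

/-- Decidable UPPER test on a squared cosine (with `cos x ≥ 0`): `0 ≤ q ≤ 3` and
(`cosUpper4Q q < 0` or `cosUpper4Q(q)²·Y² < m²`). -/
def upperTestSq (m2 Y2 q : ℚ) : Bool :=
  decide (0 ≤ q) && decide (q ≤ 3) && (decide (cosUpper4Q q < 0) || decide (cosUpper4Q q ^ 2 * Y2 < m2))

/-- Decidable sine test: `0 ≤ s` and `n² ≤ s²·Y²`. -/
def sinTestSq (n2 Y2 s : ℚ) : Bool := decide (0 ≤ s) && decide (n2 ≤ s ^ 2 * Y2)

/-- Soundness of `lowerTestSq`: `0 ≤ x`, `Y² > 0`, `cos²x·Y² = m²` ⇒ `q < x`. -/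
theorem angle_gt_of_lowerTestSq {x : ℝ} {m2 Y2 q : ℚ} (hx0 : 0 ≤ x) (hY : (0 : ℚ) < Y2)
    (hcos : cos x ^ 2 * (Y2 : ℝ) = (m2 : ℝ)) (h : lowerTestSq m2 Y2 q = true) : (q : ℝ) < x := by
  simp only [lowerTestSq, Bool.and_eq_true, decide_eq_true_eq] at h
  obtain ⟨⟨⟨⟨⟨⟨⟨hq3, h0⟩, h1⟩, h2⟩, h3⟩, h4⟩, hcl⟩, hm⟩ := h
  have hqπ : (q : ℝ) ≤ π := by
    have : (q : ℝ) ≤ 3 := by exact_mod_cast hq3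
    linarith [pi_gt_three]
  have hY' : (0 : ℝ) < Y2 := by exact_mod_cast hY
  have hcl' : (0 : ℝ) ≤ cosLower5 (q : ℝ) := by
    have := (Rat.cast_le (K := ℝ)).mpr hcl; rw [Rat.cast_zero, cast_cosLower5Q] at this; exact this
  have hlt : cos x < cosLower5 (q : ℝ) := by
    have hm' := (Rat.cast_lt (K := ℝ)).mpr hm
    rw [← hcos, Rat.cast_mul, Rat.cast_pow, cast_cosLower5Q] at hm'
    have hsq : cos x ^ 2 < cosLower5 (q : ℝ) ^ 2 := lt_of_mul_lt_mul_right hm' hY'.le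
    exact (le_abs_self _).trans_lt (abs_lt_of_sq_lt_sq hsq hcl')
  refine angle_gt_of_chain5 hx0 hqπ ?_ ?_ ?_ ?_ ?_ hlt
  · have := (Rat.cast_le (K := ℝ)).mpr h0; push_cast at this; linarith
  · have := (Rat.cast_le (K := ℝ)).mpr h1; rw [Rat.cast_zero, cast_dblQ] at this; push_cast at this; exact this
  · have := (Rat.cast_le (K := ℝ)).mpr h2; rw [Rat.cast_zero, cast_dblQ, cast_dblQ] at this
    push_cast at this; exact this
  · have := (Rat.cast_le (K := ℝ)).mpr h3; rw [Rat.cast_zero, cast_dblQ, cast_dblQ, cast_dblQ] at this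
    push_cast at this; exact this
  · have := (Rat.cast_le (K := ℝ)).mpr h4
    rw [Rat.cast_zero, cast_dblQ, cast_dblQ, cast_dblQ, cast_dblQ] at this
    push_cast at this; exact this

/-- Soundness of `upperTestSq`: `x ≤ π`, `cos x ≥ 0`, `Y² > 0`, `cos²x·Y² = m²` ⇒ `x < q`. -/
theorem angle_lt_of_upperTestSq {x : ℝ} {m2 Y2 q : ℚ} (hxπ : x ≤ π) (hc0 : 0 ≤ cos x) (hY : (0 : ℚ) < Y2)
    (hcos : cos x ^ 2 * (Y2 : ℝ) = (m2 : ℝ)) (h : upperTestSq m2 Y2 q = true) : x < (q : ℝ) := by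
  simp only [upperTestSq, Bool.and_eq_true, Bool.or_eq_true, decide_eq_true_eq] at h
  obtain ⟨⟨hq0, hq3⟩, hor⟩ := h
  have hqπ : (q : ℝ) ≤ π := by
    have : (q : ℝ) ≤ 3 := by exact_mod_cast hq3
    linarith [pi_gt_three]
  have hY' : (0 : ℝ) < Y2 := by exact_mod_cast hY
  have hlt : cosUpper4 (q : ℝ) < cos x := by
    rcases hor with hneg | hsq
    · have := (Rat.cast_lt (K := ℝ)).mpr hneg; rw [cast_cosUpper4Q, Rat.cast_zero] at this
      exact this.trans_le hc0
    · have hsq' := (Rat.cast_lt (K := ℝ)).mpr hsq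
      rw [← hcos, Rat.cast_mul, Rat.cast_pow, cast_cosUpper4Q] at hsq'
      have h2 : cosUpper4 (q : ℝ) ^ 2 < cos x ^ 2 := lt_of_mul_lt_mul_right hsq' hY'.le
      exact (le_abs_self _).trans_lt (abs_lt_of_sq_lt_sq h2 hc0)
  exact angle_lt_of_chain hxπ (by exact_mod_cast hq0) hqπ hlt

/-- Soundness of `sinTestSq`: `Y² > 0`, `sin²x·Y² = n²` ⇒ `|sin x| ≤ s`. -/
theorem abs_sin_le_of_sinTestSq {x : ℝ} {n2 Y2 s : ℚ} (hY : (0 : ℚ) < Y2)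
    (hsin : sin x ^ 2 * (Y2 : ℝ) = (n2 : ℝ)) (h : sinTestSq n2 Y2 s = true) : |sin x| ≤ (s : ℝ) := by
  simp only [sinTestSq, Bool.and_eq_true, decide_eq_true_eq] at h
  obtain ⟨hs0, hn⟩ := h
  have hY' : (0 : ℝ) < Y2 := by exact_mod_cast hY
  have hn' := (Rat.cast_le (K := ℝ)).mpr hn
  rw [← hsin, Rat.cast_mul, Rat.cast_pow] at hn'
  have h2 : sin x ^ 2 ≤ (s : ℝ) ^ 2 := le_of_mul_le_mul_right hn' hY'
  exact abs_le_of_sq_le_sq h2 (by exact_mod_cast hs0)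

/-- **Rational LOWER bound of the sector gain** [cite: VuTuritsyn2017, §4.1 eq. (bound)]: `|x| < π/2`,
`|sin x| ≤ s ≤ 1`, `L ≤ |x|`, `π ≤ P` ⇒ `(1 − s)/(P/2 − L) ≤ sectorGain x`. -/
theorem sectorGain_ge_of_bounds {x s L P : ℝ} (hx : |x| < π / 2) (hs : |sin x| ≤ s) (hs1 : s ≤ 1)
    (hL : L ≤ |x|) (hP : π ≤ P) : (1 - s) / (P / 2 - L) ≤ sectorGain x := by
  unfold sectorGain
  rw [sin_abs_eq_abs_sin (by linarith [hx.le, pi_pos])]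
  exact div_le_div₀ (by linarith [abs_nonneg (sin x), hs]) (by linarith) (by linarith) (by linarith)

/-- **Rational LOWER bound of the face term** `(π/2 − |x|)²`: `|x| ≤ U ≤ P/2`, `P ≤ π`. -/
theorem sq_halfpi_sub_ge_of_bounds {x U P : ℝ} (hU : |x| ≤ U) (hP : P ≤ π) (h2 : U ≤ P / 2) :
    (P / 2 - U) ^ 2 ≤ (π / 2 - |x|) ^ 2 :=
  pow_le_pow_left₀ (by linarith) (by linarith) 2

end AngleEnclosure

open AngleEnclosure

/-! ### Channel identities on the recast data (rational squares of the shifted angle's cos / sin) -/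

namespace ClassicalSwing

variable {n : ℕ} (p : ClassicalSwing n)

/-- `Y_ij sin(x + θ_ij) = B_ij sin x + G_ij cos x`. -/
theorem Ypol_mul_sin_add {i j : Fin n} (hB : 0 < p.B i j) (x : ℝ) :
    p.Ypol i j * sin (x + p.θpol i j) = p.B i j * sin x + p.G i j * cos x := by
  rw [sin_add, p.B_eq_polar hB, p.G_eq_polar hB]; ring

/-- `Y_ij² = B_ij² + G_ij²`. -/
theorem Ypol_sq (i j : Fin n) : p.Ypol i j ^ 2 = p.B i j ^ 2 + p.G i j ^ 2 := by
  unfold Ypol; rw [Real.sq_sqrt (by positivity)]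

/-- Zero susceptance ⇒ zero phase (`arctan(G/0) = 0` with Lean's `x/0 = 0`). -/
theorem θpol_eq_zero_of_B_eq_zero {i j : Fin n} (h : p.B i j = 0) : p.θpol i j = 0 := by
  simp [θpol, h]

end ClassicalSwing

namespace RecastData

variable {n : ℕ} (d : RecastData n) {δs : Fin (n + 1) → ℝ}

/-- The sine numerator of the shifted angle: `B·sd + G·cd` (`= Y_ij sin(δˢ_ij + θ_ij)` under `EqData`). -/
def dirSinB (i j : Fin (n + 1)) : ℚ := d.B i j * d.sd i j + d.G i j * d.cd i j

/-- `Y_ij² = B_ij² + G_ij²` as a rational. -/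
def Ysq (i j : Fin (n + 1)) : ℚ := d.B i j ^ 2 + d.G i j ^ 2

/-- Under `EqData`: `B sin δˢ_ij + G cos δˢ_ij = dirSinB` (cast). -/
theorem dirSinB_cast (hE : d.EqData δs) (i j : Fin (n + 1)) :
    d.toModel.B i j * sin (δs i - δs j) + d.toModel.G i j * cos (δs i - δs j) = (d.dirSinB i j : ℝ) := by
  rw [← d.cd_cast hE, ← d.sd_cast hE]
  push_cast [dirSinB, toModel]
  ring

/-- `toModel.Ypol² = Ysq` (cast). -/
theorem Ypol_sq_cast (i j : Fin (n + 1)) : d.toModel.Ypol i j ^ 2 = (d.Ysq i j : ℝ) := by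
  rw [d.toModel.Ypol_sq]; push_cast [Ysq, toModel]; ring

/-- **`cos²(δˢ_ij + θ_ij) · Y² = dirMarginB²`** (`i ≠ j`, `B_ij > 0`). -/
theorem cos_sq_dirAngle (hE : d.EqData δs) {i j : Fin (n + 1)} (hB : 0 < d.B i j) :
    cos (δs i - δs j + d.toModel.θpol i j) ^ 2 * (d.Ysq i j : ℝ) = ((d.dirMarginB i j ^ 2 : ℚ) : ℝ) := by
  have hB' : 0 < d.toModel.B i j := by show (0:ℝ) < (d.B i j : ℝ); exact_mod_cast hB
  have h := d.toModel.Ypol_mul_cos_add hB' (δs i - δs j)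
  rw [d.dirMarginB_cast hE] at h
  rw [← d.Ypol_sq_cast, Rat.cast_pow, ← h]; ring

/-- **`sin²(δˢ_ij + θ_ij) · Y² = dirSinB²`** (`i ≠ j`, `B_ij > 0`). -/
theorem sin_sq_dirAngle (hE : d.EqData δs) {i j : Fin (n + 1)} (hB : 0 < d.B i j) :
    sin (δs i - δs j + d.toModel.θpol i j) ^ 2 * (d.Ysq i j : ℝ) = ((d.dirSinB i j ^ 2 : ℚ) : ℝ) := by
  have hB' : 0 < d.toModel.B i j := by show (0:ℝ) < (d.B i j : ℝ); exact_mod_cast hB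
  have h := d.toModel.Ypol_mul_sin_add hB' (δs i - δs j)
  rw [d.dirSinB_cast hE] at h
  rw [← d.Ypol_sq_cast, Rat.cast_pow, ← h]; ring

/-- Zero self-susceptance ⇒ the diagonal (weightless) channel has shift `0`. -/
theorem channelShift_self (hBd : ∀ i, d.B i i = 0) (δs : Fin (n + 1) → ℝ) (i : Fin (n + 1)) :
    InternalNode.channelShift d.toModel.θpol δs (i, i) = 0 := by
  unfold InternalNode.channelShift
  rw [d.toModel.θpol_eq_zero_of_B_eq_zero (by show ((d.B i i : ℚ) : ℝ) = 0; rw [hBd i]; push_cast; rfl)]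
  ring

/-! ### Per-channel tables ⇒ enclosures of `|δ*_k|`, sine bound, gain and face bounds -/

/-- `Y² > 0` off the diagonal when `B_ij > 0`. -/
theorem Ysq_pos (hB : ∀ i j : Fin (n + 1), i ≠ j → 0 < d.B i j) {i j : Fin (n + 1)} (h : i ≠ j) :
    0 < d.Ysq i j := by
  have := hB i j h; unfold Ysq; nlinarith [sq_nonneg (d.G i j)]

/-- Rational lower bound of the sector gain of channel `(i, j)` from tables: `(1 − sHi)/(1.5708 − lo)`. -/
def gainLoQ (lo sHi : Fin (n + 1) → Fin (n + 1) → ℚ) (i j : Fin (n + 1)) : ℚ :=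
  (1 - sHi i j) / (15708 / 10000 - lo i j)

/-- Rational lower bound of the face term of channel `(i, j)` from tables: `(1.57075 − hi)²`. -/
def faceLoQ (hi : Fin (n + 1) → Fin (n + 1) → ℚ) (i j : Fin (n + 1)) : ℚ := (31415 / 20000 - hi i j) ^ 2

omit d in
/-- Cast of `gainLoQ`. -/
theorem gainLoQ_cast (lo sHi : Fin (n + 1) → Fin (n + 1) → ℚ) (i j : Fin (n + 1)) :
    ((gainLoQ lo sHi i j : ℚ) : ℝ) = (1 - (sHi i j : ℝ)) / ((31416 : ℝ) / 10000 / 2 - (lo i j : ℝ)) := by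
  push_cast [gainLoQ]; ring

/-- **Lower enclosure** `lo ≤ |δ*_k|` on every channel, from tables passing the decidable tests
(`hdiag` for the weightless diagonal, `htest` off the diagonal). -/
theorem channel_lo_le (hE : d.EqData d.angleOf) (hB : ∀ i j : Fin (n + 1), i ≠ j → 0 < d.B i j)
    (hBd : ∀ i : Fin (n + 1), d.B i i = 0) (lo hi sHi : Fin (n + 1) → Fin (n + 1) → ℚ)
    (hdiag : ∀ i : Fin (n + 1), lo i i ≤ 0 ∧ 0 ≤ hi i i ∧ 0 ≤ sHi i i)
    (htest : ∀ i j : Fin (n + 1), i ≠ j →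
      lowerTestSq (d.dirMarginB i j ^ 2) (d.Ysq i j) (lo i j) = true ∧
      upperTestSq (d.dirMarginB i j ^ 2) (d.Ysq i j) (hi i j) = true ∧
      sinTestSq (d.dirSinB i j ^ 2) (d.Ysq i j) (sHi i j) = true)
    (k : Fin (n + 1) × Fin (n + 1)) :
    ((lo k.1 k.2 : ℚ) : ℝ) ≤ |InternalNode.channelShift d.toModel.θpol d.angleOf k| := by
  by_cases h : k.1 = k.2
  · obtain ⟨a, b⟩ := k
    simp only at h; subst h
    rw [d.channelShift_self hBd, abs_zero]; exact_mod_cast (hdiag a).1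
  · obtain ⟨hl, -, -⟩ := htest k.1 k.2 h
    have hcos : cos |InternalNode.channelShift d.toModel.θpol d.angleOf k| ^ 2 * (d.Ysq k.1 k.2 : ℝ)
        = ((d.dirMarginB k.1 k.2 ^ 2 : ℚ) : ℝ) := by
      rw [cos_abs]; exact d.cos_sq_dirAngle hE (hB k.1 k.2 h)
    exact (angle_gt_of_lowerTestSq (abs_nonneg _) (d.Ysq_pos hB h) hcos hl).le

/-- **Upper enclosure** `|δ*_k| ≤ hi` on every channel. -/
theorem channel_le_hi (hE : d.EqData d.angleOf) (hB : ∀ i j : Fin (n + 1), i ≠ j → 0 < d.B i j)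
    (hBd : ∀ i : Fin (n + 1), d.B i i = 0) (hs : ∀ i, 0 ≤ d.s i) (hc : ∀ i, 0 < d.c i)
    (hm : ∀ i j : Fin (n + 1), i ≠ j → 0 < d.dirMarginB i j) (lo hi sHi : Fin (n + 1) → Fin (n + 1) → ℚ)
    (hdiag : ∀ i : Fin (n + 1), lo i i ≤ 0 ∧ 0 ≤ hi i i ∧ 0 ≤ sHi i i)
    (htest : ∀ i j : Fin (n + 1), i ≠ j →
      lowerTestSq (d.dirMarginB i j ^ 2) (d.Ysq i j) (lo i j) = true ∧
      upperTestSq (d.dirMarginB i j ^ 2) (d.Ysq i j) (hi i j) = true ∧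
      sinTestSq (d.dirSinB i j ^ 2) (d.Ysq i j) (sHi i j) = true)
    (k : Fin (n + 1) × Fin (n + 1)) :
    |InternalNode.channelShift d.toModel.θpol d.angleOf k| ≤ ((hi k.1 k.2 : ℚ) : ℝ) := by
  by_cases h : k.1 = k.2
  · obtain ⟨a, b⟩ := k
    simp only at h; subst h
    rw [d.channelShift_self hBd, abs_zero]; exact_mod_cast (hdiag a).2.1
  · obtain ⟨-, hu, -⟩ := htest k.1 k.2 h
    have hwin := d.channelShift_abs_lt_of_margins hE hB hs hc hm k
    have hnn := abs_nonneg (InternalNode.channelShift d.toModel.θpol d.angleOf k)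
    have hcos : cos |InternalNode.channelShift d.toModel.θpol d.angleOf k| ^ 2 * (d.Ysq k.1 k.2 : ℝ)
        = ((d.dirMarginB k.1 k.2 ^ 2 : ℚ) : ℝ) := by
      rw [cos_abs]; exact d.cos_sq_dirAngle hE (hB k.1 k.2 h)
    have hc0 : 0 ≤ cos |InternalNode.channelShift d.toModel.θpol d.angleOf k| :=
      cos_nonneg_of_neg_pi_div_two_le_of_le (by linarith) hwin.le
    exact (angle_lt_of_upperTestSq (by linarith [hwin.le, pi_pos]) hc0 (d.Ysq_pos hB h) hcos hu).le

/-- **Sine bound** `|sin δ*_k| ≤ sHi` on every channel. -/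
theorem channel_abs_sin_le (hE : d.EqData d.angleOf) (hB : ∀ i j : Fin (n + 1), i ≠ j → 0 < d.B i j)
    (hBd : ∀ i : Fin (n + 1), d.B i i = 0) (lo hi sHi : Fin (n + 1) → Fin (n + 1) → ℚ)
    (hdiag : ∀ i : Fin (n + 1), lo i i ≤ 0 ∧ 0 ≤ hi i i ∧ 0 ≤ sHi i i)
    (htest : ∀ i j : Fin (n + 1), i ≠ j →
      lowerTestSq (d.dirMarginB i j ^ 2) (d.Ysq i j) (lo i j) = true ∧
      upperTestSq (d.dirMarginB i j ^ 2) (d.Ysq i j) (hi i j) = true ∧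
      sinTestSq (d.dirSinB i j ^ 2) (d.Ysq i j) (sHi i j) = true)
    (k : Fin (n + 1) × Fin (n + 1)) :
    |sin (InternalNode.channelShift d.toModel.θpol d.angleOf k)| ≤ ((sHi k.1 k.2 : ℚ) : ℝ) := by
  by_cases h : k.1 = k.2
  · obtain ⟨a, b⟩ := k
    simp only at h; subst h
    rw [d.channelShift_self hBd, sin_zero, abs_zero]; exact_mod_cast (hdiag a).2.2
  · obtain ⟨-, -, hsn⟩ := htest k.1 k.2 h
    exact abs_sin_le_of_sinTestSq (d.Ysq_pos hB h) (d.sin_sq_dirAngle hE (hB k.1 k.2 h)) hsn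

/-- **`gainLoQ ≤ sectorGain(δ*_k)`** on every channel (needs `sHi ≤ 1`). [cite: VuTuritsyn2017, §4.1 eq. (bound)] -/
theorem gainLoQ_le_sectorGain (hE : d.EqData d.angleOf) (hB : ∀ i j : Fin (n + 1), i ≠ j → 0 < d.B i j)
    (hBd : ∀ i : Fin (n + 1), d.B i i = 0) (hs : ∀ i, 0 ≤ d.s i) (hc : ∀ i, 0 < d.c i)
    (hm : ∀ i j : Fin (n + 1), i ≠ j → 0 < d.dirMarginB i j) (lo hi sHi : Fin (n + 1) → Fin (n + 1) → ℚ)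
    (hdiag : ∀ i : Fin (n + 1), lo i i ≤ 0 ∧ 0 ≤ hi i i ∧ 0 ≤ sHi i i)
    (htest : ∀ i j : Fin (n + 1), i ≠ j →
      lowerTestSq (d.dirMarginB i j ^ 2) (d.Ysq i j) (lo i j) = true ∧
      upperTestSq (d.dirMarginB i j ^ 2) (d.Ysq i j) (hi i j) = true ∧
      sinTestSq (d.dirSinB i j ^ 2) (d.Ysq i j) (sHi i j) = true)
    (hs1 : ∀ i j, sHi i j ≤ 1) (k : Fin (n + 1) × Fin (n + 1)) :
    ((gainLoQ lo sHi k.1 k.2 : ℚ) : ℝ) ≤ sectorGain (InternalNode.channelShift d.toModel.θpol d.angleOf k) := by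
  rw [gainLoQ_cast]
  exact sectorGain_ge_of_bounds (d.channelShift_abs_lt_of_margins hE hB hs hc hm k)
    (d.channel_abs_sin_le hE hB hBd lo hi sHi hdiag htest k) (by exact_mod_cast hs1 k.1 k.2)
    (d.channel_lo_le hE hB hBd lo hi sHi hdiag htest k) pi_le_31416

/-- **`faceLoQ ≤ (π/2 − |δ*_k|)²`** on every channel (needs `hi ≤ 1.57075`). -/
theorem faceLoQ_le (hE : d.EqData d.angleOf) (hB : ∀ i j : Fin (n + 1), i ≠ j → 0 < d.B i j)
    (hBd : ∀ i : Fin (n + 1), d.B i i = 0) (hs : ∀ i, 0 ≤ d.s i) (hc : ∀ i, 0 < d.c i)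
    (hm : ∀ i j : Fin (n + 1), i ≠ j → 0 < d.dirMarginB i j) (lo hi sHi : Fin (n + 1) → Fin (n + 1) → ℚ)
    (hdiag : ∀ i : Fin (n + 1), lo i i ≤ 0 ∧ 0 ≤ hi i i ∧ 0 ≤ sHi i i)
    (htest : ∀ i j : Fin (n + 1), i ≠ j →
      lowerTestSq (d.dirMarginB i j ^ 2) (d.Ysq i j) (lo i j) = true ∧
      upperTestSq (d.dirMarginB i j ^ 2) (d.Ysq i j) (hi i j) = true ∧
      sinTestSq (d.dirSinB i j ^ 2) (d.Ysq i j) (sHi i j) = true)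
    (hh : ∀ i j, hi i j ≤ 31415 / 20000) (k : Fin (n + 1) × Fin (n + 1)) :
    ((faceLoQ hi k.1 k.2 : ℚ) : ℝ) ≤ (π / 2 - |InternalNode.channelShift d.toModel.θpol d.angleOf k|) ^ 2 := by
  have h := sq_halfpi_sub_ge_of_bounds (d.channel_le_hi hE hB hBd hs hc hm lo hi sHi hdiag htest k)
    pi_ge_31415 (by have := (Rat.cast_le (K := ℝ)).mpr (hh k.1 k.2); push_cast at this; linarith)
  push_cast [faceLoQ] at h ⊢
  linarith

end RecastData

/-! ### Instance of record «WSCC9-postB-SPdamp-h12» -/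

namespace WSCC9

/-- Certified LOWER table of the shifted channel angles `|θ*_i − θ*_j + θ_ij|` (rad, `10⁻⁵` grid; diagonal `0`). -/
def chanLo : Fin 3 → Fin 3 → ℚ := !![(0 : ℚ), (9831 : ℚ)/20000, (6227 : ℚ)/25000; (17319 : ℚ)/20000, (0 : ℚ), (10371 : ℚ)/25000; (29969 : ℚ)/50000, (471 : ℚ)/5000, (0 : ℚ)]

/-- Certified UPPER table of the shifted channel angles. -/
def chanHi : Fin 3 → Fin 3 → ℚ := !![(0 : ℚ), (49157 : ℚ)/100000, (24909 : ℚ)/100000; (86601 : ℚ)/100000, (0 : ℚ), (20743 : ℚ)/50000; (2997 : ℚ)/5000, (9421 : ℚ)/100000, (0 : ℚ)]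

/-- Certified UPPER table of `|sin|` of the shifted channel angles (`10⁻⁶` grid). -/
def chanSinHi : Fin 3 → Fin 3 → ℚ := !![(0 : ℚ), (472001 : ℚ)/1000000, (6163 : ℚ)/25000; (76173 : ℚ)/100000, (0 : ℚ), (80611 : ℚ)/200000; (28207 : ℚ)/50000, (94069 : ℚ)/1000000, (0 : ℚ)]

/-- Zero self-susceptance in the typed reduction (diagonal of `B` is `0`). -/
theorem postB_SPdamp_B_self : ∀ i : Fin 3, postB_SPdamp.B i i = 0 := by decide +kernel

/-- Diagonal table entries are `0 / 0 / 0`-compatible. -/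
theorem chan_diag : ∀ i : Fin 3, chanLo i i ≤ 0 ∧ 0 ≤ chanHi i i ∧ 0 ≤ chanSinHi i i := by decide +kernel

/-- The six off-diagonal channels pass the three decidable tests (ONE `decide`). -/
theorem chan_test : ∀ i j : Fin 3, i ≠ j →
    lowerTestSq (postB_SPdamp.dirMarginB i j ^ 2) (postB_SPdamp.Ysq i j) (chanLo i j) = true ∧
    upperTestSq (postB_SPdamp.dirMarginB i j ^ 2) (postB_SPdamp.Ysq i j) (chanHi i j) = true ∧
    sinTestSq (postB_SPdamp.dirSinB i j ^ 2) (postB_SPdamp.Ysq i j) (chanSinHi i j) = true := by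
  decide +kernel

/-- `sHi ≤ 1` and `hi ≤ 1.57075` (table sanity). -/
theorem chan_ranges : (∀ i j : Fin 3, chanSinHi i j ≤ 1) ∧ ∀ i j : Fin 3, chanHi i j ≤ 31415 / 20000 := by
  refine ⟨?_, ?_⟩ <;> decide +kernel

/-- **Certified enclosure of every shifted channel angle** of the instance of record. -/
theorem postB_SPdamp_channel_bounds (k : Fin 3 × Fin 3) :
    ((chanLo k.1 k.2 : ℚ) : ℝ) ≤ |InternalNode.channelShift postB_SPdamp.toModel.θpol postB_SPdamp.angleOf k| ∧
    |InternalNode.channelShift postB_SPdamp.toModel.θpol postB_SPdamp.angleOf k| ≤ ((chanHi k.1 k.2 : ℚ) : ℝ) :=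
  ⟨postB_SPdamp.channel_lo_le postB_SPdamp_eqData postB_SPdamp_B_pos postB_SPdamp_B_self chanLo chanHi chanSinHi
      chan_diag chan_test k,
   postB_SPdamp.channel_le_hi postB_SPdamp_eqData postB_SPdamp_B_pos postB_SPdamp_B_self postB_SPdamp_acute.1
      postB_SPdamp_acute.2 postB_SPdamp_dirMarginB_pos chanLo chanHi chanSinHi chan_diag chan_test k⟩

/-- The minimum of the rational gain bounds is at least `169/500 = 0.338` (channel 2→1: 0.338044). -/
theorem gainLoQ_ge : ∀ i j : Fin 3, (169 : ℚ) / 500 ≤ RecastData.gainLoQ chanLo chanSinHi i j := by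
  decide +kernel

/-- **CERTIFIED sector-gain floor for «WSCC9-postB-SPdamp-h12»**: `0.338 ≤ sectorGain(δ*_k)` on all nine
channels (six directed + three weightless diagonal ones). -/
theorem postB_SPdamp_sectorGain_ge (k : Fin 3 × Fin 3) :
    (169 : ℝ) / 500 ≤ sectorGain (InternalNode.channelShift postB_SPdamp.toModel.θpol postB_SPdamp.angleOf k) := by
  have h1 := postB_SPdamp.gainLoQ_le_sectorGain postB_SPdamp_eqData postB_SPdamp_B_pos postB_SPdamp_B_self
    postB_SPdamp_acute.1 postB_SPdamp_acute.2 postB_SPdamp_dirMarginB_pos chanLo chanHi chanSinHi chan_diag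
    chan_test chan_ranges.1 k
  have h2 := (Rat.cast_le (K := ℝ)).mpr (gainLoQ_ge k.1 k.2)
  push_cast at h2
  exact h2.trans h1

/-- **`hg` of `WSCC9.lurie_roa` from ONE rational comparison**: any certificate gain `g < 169/500` is below
every channel's sector gain. -/
theorem hg_of_lt {g : ℝ} (hg : g < (169 : ℝ) / 500) (k : Fin 3 × Fin 3) :
    g < sectorGain (InternalNode.channelShift postB_SPdamp.toModel.θpol postB_SPdamp.angleOf k) :=
  hg.trans_le (postB_SPdamp_sectorGain_ge k)

/-- **CERTIFIED face floors**: `faceLoQ k ≤ (π/2 − |δ*_k|)²` on all nine channels (VALIDATED floats of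
`faceLoQ`: 1.165 / 1.747 (1→2, 1→3), 0.497 / 1.336 (2→1, 2→3), 0.944 / 2.180 (3→1, 3→2), 2.467 diagonal). -/
theorem postB_SPdamp_face_ge (k : Fin 3 × Fin 3) :
    ((RecastData.faceLoQ chanHi k.1 k.2 : ℚ) : ℝ)
      ≤ (π / 2 - |InternalNode.channelShift postB_SPdamp.toModel.θpol postB_SPdamp.angleOf k|) ^ 2 :=
  postB_SPdamp.faceLoQ_le postB_SPdamp_eqData postB_SPdamp_B_pos postB_SPdamp_B_self postB_SPdamp_acute.1
    postB_SPdamp_acute.2 postB_SPdamp_dirMarginB_pos chanLo chanHi chanSinHi chan_diag chan_test chan_ranges.2 k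

end WSCC9

end Summit.Ventures.GridStability.Models

end
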